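import Summits.ABC.IUTFork.Cor312VolumesPadicSummandsM
import Summits.ABC.IUTFork.Cor312FrameVolumePiecesDH
import HarnessLib

/-!
# [IUTchIII] Corollary 3.12, statement — the field-box VOLUME PIECES of the M-LEVEL real log-shells (`K_{v̲}`, `v̲ ∈ V̲`):
# a `FrameVolumePieces (logShellsOfInitialDH D logvK)` inhabitant (G1-Θ unit P2′ of `HOME/staging/w5/w5-d166/g4/G1-THETA-SHAPES.md`)

Record-only file (D-0012) of the abc-iut cell (seat abc-iut-w5-d166, gen 4; branch C «abc ⇐ S», C-lead ruling C-R12 (e)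
«target #2′: the M-level (V̲, K_{v̲}) real volume setting»; sequel of this seat's `Cor312VolumesPadicSummandsM` = unit P1).
TAKES NO SIDE on [IUTchIII] Cor. 3.12.

abc-iut-c312-6's `Cor312Vol.FrameVolumePieces L` (`Cor312VolumesRealFrames`, GENERIC over a log-shell signature `L`) is the
container of record of the adjudication's assembled real setting: abc-iut-c312-8's M-level provenance
`Cor312Prov.isSettingOf_ofFrames` (`Cor312ProvenanceFrames`) is ALREADY stated for `Setting.ofFrames` over ANY
`V : FrameVolumePieces S.L`, `S : Situation (Real.thetaIndexOfInitial D)`. What the tree lacked (abc-iut-S3 07:44:48Z (3),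
abc-iut-w5-d004 08:18:27Z (3): "MISSING PIECE = an M-level volume container") is an INHABITANT of
`FrameVolumePieces (Real.logShellsOfInitialDH D logvK)` with the GENUINE field factors. THIS FILE builds it from unit P1
exactly as abc-iut-c312-6's `Real.frameVolumePiecesDH X hlog` (`Cor312FrameVolumePiecesDH` §2) is built from abc-iut-c312-5's
`presAt X hlog pp`:

* §1 the rational prime `p_u` of a finite place `u` of `ℚ` (`ratChar`), the law `LogvAnalyticVal logvK` (analytic at every
  prime; DISCHARGED for `Real.analyticLogvVal K`), and the presentation `presAtM D hlog u` at every nonarchimedean `u`;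
* §2 the field-factor data per `(j, v_ℚ)` — `factorIdxM`/`factorFieldM`/`factorMapM` (abc-iut-c312-3's decomposition
  fields `L_{v⃗,i}` of the GENUINE prime packets `K_{v̲_0} ⊗_{ℚ_p} ⋯ ⊗_{ℚ_p} K_{v̲_j}`, [IUTchIV] Prop. 1.4 (i); EMPTY at the
  archimedean place — the same modelling choice as the F-level files' trivial archimedean container) with their instances;
* §3 **`frameVolumePiecesOfInitialDH D hlog : FrameVolumePieces (logShellsOfInitialDH D logvK)`** — comparison onto
  (c312-6 `factorMap_surjective`), Haar factor volumes normalised at `𝒪` (c312-6 `factorVolume`), frame weights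
  `W_{(v⃗,i)} = w_{v⃗}/D_{v⃗}` (c312-6 `frameWeight` over P1's `V_mod` probability weights), real hull frames
  `HullFrame.ofLocalFields` — and `frameVolumePiecesOfInitialDHAnalytic D` (no hypothesis beyond `D`); NON-VACUITY of the
  M-level container type.
Every per-prime lemma of c312-6's §1 (`frameWeight_mul_mulLogvol`, `sum_frameWeight_mul_mulLogvol`) and of c312-5's lattice files
applies verbatim to `presAtM` (they are generic over `PadicPresentation`).
[cite: Mochizuki2012, IUTchI Def. 3.1 (e) p. 62] [cite: Mochizuki2012, IUTchIV Prop. 1.4 (i) p. 13]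
[cite: MochizukiAbsTopIII2015, Prop. 5.7 (i) p. 137] [cite: DupuyHilado2025, Def. 3.6.1, §3.6]
[claim: Mochizuki2012, status: disputed] for the quoted setting. HONEST FRAMING: bookkeeping over OUR typed objects; nothing
here bears on the truth of [IUTchIII] Cor. 3.12; typed ≠ proved; instantiated ≠ endorsed. Deliberately NOT here: the
setting `Setting.ofFrames` over these pieces with Θ-boxes read off abc-iut-S2's genuine ideles (unit P4), `ThetaFinite`
(P5), the comparison with `ThetaVolumeInput.negLogTheta` (P6).
-/

noncomputable section

open Set Function NumberField IsDedekindDomain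
open scoped Pointwise

namespace Summit.ABC.IUTFork.Thm311.Real

open Cor312 Cor312Vol Literature.IUT.LogThetaLattice Literature.IUT.LogVolume Literature.IUT.HodgeTheaters
  Literature.NumberTheory.NumberFields

variable {F K Fbar : Type} [Field F] [NumberField F] [Field K] [NumberField K] [Algebra F K]
  [Field Fbar] [Algebra F Fbar] [Algebra K Fbar] {E : WeierstrassCurve F} [E.IsElliptic] {l : ℕ}
  {Pb : BadPlacePredicates K} (D : InitialThetaData F K Fbar E l Pb) {logvK : PadicLogsVal K}

/-! ## §1. The prime of a finite place of `ℚ`; analytic logarithms at every prime; the presentation at every finite place -/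

/-- The rational prime `p_u` of the finite place `u` of `ℚ` (abc-iut-c312-3's `residueChar` for the number field `ℚ`).
[cite: DupuyHilado2025, §2.5.4] -/
def ratChar (u : FinitePlace ℚ) : ℕ := residueChar ℚ (FinitePlace.maximalIdeal u)

/-- `p_u` is prime. [folklore] -/
instance fact_ratChar_prime (u : FinitePlace ℚ) : Fact (ratChar u).Prime :=
  ⟨residueChar_prime ℚ (FinitePlace.maximalIdeal u)⟩

/-- `p_u ∈ 𝔭_u`. [folklore] -/
theorem natCast_ratChar_mem (u : FinitePlace ℚ) :
    ((ratChar u : ℕ) : 𝓞 ℚ) ∈ (FinitePlace.maximalIdeal u).asIdeal :=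
  natCast_residueChar_mem ℚ (FinitePlace.maximalIdeal u)

variable (logvK) in
/-- **The family `logvK` is the ANALYTIC logarithm at every prime** (M-level twin of abc-iut-c312-5's `Real.LogvAnalytic`; a LAW
on the binder, not a fact). [cite: NeukirchANT1999, Ch. II (5.5)] -/
def LogvAnalyticVal : Prop := ∀ u : FinitePlace ℚ, LogvAnalyticAtVal (K := K) (ratChar u) logvK

/-- c312-5's analytic family `Real.analyticLogvVal K` satisfies the law — no hypothesis. [cite: NeukirchANT1999, Ch. II (5.5)] -/
theorem logvAnalyticVal_analyticLogvVal : LogvAnalyticVal (analyticLogvVal K) := fun u =>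
  logvAnalyticAtVal_analyticLogvVal (K := K) (ratChar u)

variable (hlog : LogvAnalyticVal logvK)

/-- The `p`-adic presentation of the M-level signature at the finite place `u` of `ℚ` (unit P1), with its `Fact` instance and
analyticity hypothesis supplied. [claim: Mochizuki2012, status: disputed] -/
abbrev presAtM (u : FinitePlace ℚ) : PadicPresentation (logShellsOfInitialDH D logvK) (Val.non u) (ratChar u) :=
  padicPresentationOfInitialDH D (ratChar u) u (natCast_ratChar_mem u) logvK (hlog u)

/-! ## §2. The field-factor pieces of the M-level signature at every place of `ℚ` -/

/-- Field-factor index per `(j, v_ℚ)`: `Σ_{v⃗} DIdx` over a finite place ([IUTchIV] Prop. 1.4 (i); Dupuy–Hilado Def. 3.6.1),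
EMPTY at the archimedean place (trivial archimedean container, as in the F-level files). [claim: Mochizuki2012, status: disputed] -/
def factorIdxM : ∀ (j : (thetaIndexOfInitial D).Label) (vQ : (thetaIndexOfInitial D).VQ), Type
  | _, .inl _ => PEmpty
  | j, .inr u => (presAtM D hlog u).factorIdx j

/-- … is finite. [folklore] -/
@[reducible] def factorIdxM_fintype : ∀ (j : (thetaIndexOfInitial D).Label) (vQ : (thetaIndexOfInitial D).VQ),
    Fintype (factorIdxM D hlog j vQ)
  | _, .inl _ => inferInstanceAs (Fintype PEmpty)
  | j, .inr u => by
    haveI : Fintype ((thetaIndexOfInitial D).Caps j → (thetaIndexOfInitial D).Fibre (Val.non u)) := Fintype.ofFinite _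
    exact inferInstanceAs (Fintype (Σ e : (thetaIndexOfInitial D).Caps j → (thetaIndexOfInitial D).Fibre (Val.non u),
      DIdx (ratChar u) ((presAtM D hlog u).kk e)))

/-- The field factors: abc-iut-c312-3's `DFac` over a finite place, none at `∞`. [cite: Mochizuki2012, IUTchIV Prop. 1.4 (i) p. 13] -/
def factorFieldM : ∀ (j : (thetaIndexOfInitial D).Label) (vQ : (thetaIndexOfInitial D).VQ), factorIdxM D hlog j vQ → Type
  | _, .inl _ => fun s => s.elim
  | j, .inr u => fun s => (presAtM D hlog u).factorField j s

/-- … are nontrivially normed fields. [folklore] -/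
@[reducible] def factorFieldM_field : ∀ (j : (thetaIndexOfInitial D).Label) (vQ : (thetaIndexOfInitial D).VQ)
    (s : factorIdxM D hlog j vQ), NontriviallyNormedField (factorFieldM D hlog j vQ s)
  | _, .inl _, s => s.elim
  | _, .inr u, s => inferInstanceAs (NontriviallyNormedField (DFac (ratChar u) _ s.2))

/-- … ultrametric. [folklore] -/
theorem factorFieldM_ultra : ∀ (j : (thetaIndexOfInitial D).Label) (vQ : (thetaIndexOfInitial D).VQ)
    (s : factorIdxM D hlog j vQ),
    @IsUltrametricDist (factorFieldM D hlog j vQ s) (factorFieldM_field D hlog j vQ s).toNormedField.toMetricSpace.toDist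
  | _, .inl _, s => s.elim
  | _, .inr u, s => isUltrametricDist_dFac (ratChar u) _ s.2

/-- … proper. [folklore] -/
theorem factorFieldM_proper : ∀ (j : (thetaIndexOfInitial D).Label) (vQ : (thetaIndexOfInitial D).VQ)
    (s : factorIdxM D hlog j vQ),
    @ProperSpace (factorFieldM D hlog j vQ s)
      (factorFieldM_field D hlog j vQ s).toNormedField.toMetricSpace.toPseudoMetricSpace
  | _, .inl _, s => s.elim
  | _, .inr u, s => properSpace_dFac (ratChar u) _ s.2

attribute [instance] factorIdxM_fintype factorFieldM_field factorFieldM_ultra factorFieldM_proper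

/-- The field-factor comparison `𝓘^ℚ(^{S^±_{j+1}};𝒟^⊢_{v_ℚ}) → Π_{(v⃗,i)} L_{v⃗,i}` at the M level. [claim: Mochizuki2012, status: disputed] -/
def factorMapM : ∀ (j : (thetaIndexOfInitial D).Label) (vQ : (thetaIndexOfInitial D).VQ),
    (logShellsOfInitialDH D logvK).Packet j vQ → ∀ s : factorIdxM D hlog j vQ, factorFieldM D hlog j vQ s
  | _, .inl _ => fun _ s => s.elim
  | j, .inr u => fun x s => (presAtM D hlog u).factorMap j x s

/-- **The field-factor comparison is ONTO at every place** (c312-6 `factorMap_surjective` at a finite place; empty index at `∞`).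
[folklore] -/
theorem factorMapM_surjective : ∀ (j : (thetaIndexOfInitial D).Label) (vQ : (thetaIndexOfInitial D).VQ),
    Function.Surjective (factorMapM D hlog j vQ)
  | _, .inl _ => fun _ => ⟨0, funext fun s => s.elim⟩
  | j, .inr u => (presAtM D hlog u).factorMap_surjective j

/-- The factor volumes: Haar normalised by `μ(𝒪) = 1` on each decomposition field (c312-6 `factorVolume`), nothing at `∞`.
[cite: MochizukiAbsTopIII2015, Prop. 5.7 (i) p. 137] -/
def factorVolumeM : ∀ (j : (thetaIndexOfInitial D).Label) (vQ : (thetaIndexOfInitial D).VQ) (s : factorIdxM D hlog j vQ),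
    FactorVolume (factorFieldM D hlog j vQ s)
  | _, .inl _, s => s.elim
  | j, .inr u, s => (presAtM D hlog u).factorVolume j s

/-- The frame weights: `W_{(v⃗,i)} = w_{v⃗}/D_{v⃗}` with P1's `V_mod` probability weights (c312-6 `frameWeight`), nothing at `∞`.
[cite: Mochizuki2012, IUTchIII Rmk. 3.1.1 (ii) p. 94] -/
def frameWeightOfInitial : ∀ (j : (thetaIndexOfInitial D).Label) (vQ : (thetaIndexOfInitial D).VQ),
    factorIdxM D hlog j vQ → ℝ
  | _, .inl _ => fun s => s.elim
  | j, .inr u => fun s => (presAtM D hlog u).frameWeight j s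

/-- The frame weights are nonnegative. [folklore] -/
theorem frameWeightOfInitial_nonneg : ∀ (j : (thetaIndexOfInitial D).Label) (vQ : (thetaIndexOfInitial D).VQ)
    (s : factorIdxM D hlog j vQ), 0 ≤ frameWeightOfInitial D hlog j vQ s
  | _, .inl _, s => s.elim
  | j, .inr u, s => (presAtM D hlog u).frameWeight_nonneg j s

/-! ## §3. The inhabitant -/

/-- **THE M-LEVEL INHABITANT — the field-box volume pieces of the REAL log-shells `K_{v̲}`, `v̲ ∈ V̲`, at the Dupuy–Hilado
level**: field factors = abc-iut-c312-3's decomposition fields of the GENUINE prime packets `K_{v̲_0} ⊗_{ℚ_p} ⋯ ⊗_{ℚ_p} K_{v̲_j}`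
(empty at `∞`), comparison `factorMapM` (onto), Haar factor volumes normalised at `𝒪`, weights `w_{v⃗}/D_{v⃗}` over the `V_mod`
probability weights, real hull frames `HullFrame.ofLocalFields` with hull-sets `λ·𝒪_L` — a term of abc-iut-c312-6's
`Cor312Vol.FrameVolumePieces` over abc-iut-c312-5's M-level signature, the container that abc-iut-c312-8's M-level provenance
`Cor312Prov.isSettingOf_ofFrames` and c312-6/c312-7's `Setting.ofFrames`/`settingOfFrameVolumes` consume.
[claim: Mochizuki2012, status: disputed] -/
def frameVolumePiecesOfInitialDH : FrameVolumePieces (logShellsOfInitialDH D logvK) where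
  J := factorIdxM D hlog
  instFintype := factorIdxM_fintype D hlog
  K := factorFieldM D hlog
  instField := factorFieldM_field D hlog
  e := factorMapM D hlog
  e_surjective := factorMapM_surjective D hlog
  vol := factorVolumeM D hlog
  w := frameWeightOfInitial D hlog
  w_nonneg := frameWeightOfInitial_nonneg D hlog
  frameK j vQ := HullFrame.ofLocalFields (factorFieldM D hlog j vQ)
  hul_iff _ _ _ := Iff.rfl

include hlog in
/-- Hence `FrameVolumePieces (Real.logShellsOfInitialDH D logvK)` is INHABITED for every `logvK` analytic at all primes
(non-vacuity record of the M-level container type). [folklore] -/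
theorem nonempty_frameVolumePiecesOfInitialDH : Nonempty (FrameVolumePieces (logShellsOfInitialDH D logvK)) :=
  ⟨frameVolumePiecesOfInitialDH D hlog⟩

/-- The pieces for c312-5's ANALYTIC logarithm family `Real.analyticLogvVal K` — NO hypothesis beyond the initial Θ-data `D`.
[claim: Mochizuki2012, status: disputed] -/
def frameVolumePiecesOfInitialDHAnalytic : FrameVolumePieces (logShellsOfInitialDH D (analyticLogvVal K)) :=
  frameVolumePiecesOfInitialDH D (logvAnalyticVal_analyticLogvVal (K := K))

/-- … so `FrameVolumePieces (Real.logShellsOfInitialDH D (Real.analyticLogvVal K))` is inhabited outright. [folklore] -/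
theorem nonempty_frameVolumePiecesOfInitialDH_analytic :
    Nonempty (FrameVolumePieces (logShellsOfInitialDH D (analyticLogvVal K))) :=
  ⟨frameVolumePiecesOfInitialDHAnalytic D⟩

/-- The comparison of the pieces IS `factorMapM`. [folklore] -/
theorem frameVolumePiecesOfInitialDH_e : (frameVolumePiecesOfInitialDH D hlog).e = factorMapM D hlog := rfl

/-- At a finite place the factor index of the pieces IS the per-prime presentation's `factorIdx` (definitional; recorded so that
c312-5's per-prime lattice lemmas over `presAtM` can be quoted at the pieces). [folklore] -/
theorem frameVolumePiecesOfInitialDH_J_non (j : (thetaIndexOfInitial D).Label) (u : FinitePlace ℚ) :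
    (frameVolumePiecesOfInitialDH D hlog).J j (Val.non u) = (presAtM D hlog u).factorIdx j := rfl

/-- At the archimedean place the factor index is empty (trivial archimedean container). [folklore] -/
theorem frameVolumePiecesOfInitialDH_J_arc (j : (thetaIndexOfInitial D).Label) (u : InfinitePlace ℚ) :
    (frameVolumePiecesOfInitialDH D hlog).J j (Val.arc u) = PEmpty := rfl

end Summit.ABC.IUTFork.Thm311.Real

end
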